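import Mathlib.NumberTheory.ModularForms.JacobiTheta.TwoVariable
import Literature.MathematicalPhysics.QuantumLattice.HeatKernelGroup
import HarnessLib

/-!
# The heat kernel of the circle group is a Jacobi theta value — proved

Sibling proof file of `HeatKernelGroup.lean` (topic `Literature/MathematicalPhysics/QuantumLattice`;
the sibling `HeatKernelGroupProofs.lean` discharges `IsGroupHeatKernel.comp_mul`): it discharges
the named fact

* `Literature.MathematicalPhysics.QuantumLattice.circleHeatKernel_eq_jacobiTheta₂`:
  for `t > 0` and `θ ∈ ℝ`,
  `circleHeatKernel t (Circle.exp θ) = jacobiTheta₂ (θ / 2π) (I t / 2π)`, where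
  `circleHeatKernel t z = ∑_{n ∈ ℤ} e^{-n²t/2} Re (zⁿ)`,

as `Literature.MathematicalPhysics.QuantumLattice.circleHeatKernel_eq_jacobiTheta₂_holds`, from
Mathlib's two-variable Jacobi theta function alone.  No result is assumed: the file is sorry- and
axiom-free beyond Mathlib.

## Source

* E. M. Stein, *Topics in Harmonic Analysis Related to the Littlewood–Paley Theory*, Annals of
  Mathematics Studies **63**, Princeton UP (1970).  Ch. II §1, Theorem 1 and formula (c): the heat
  semigroup `T^t = e^{tΔ}` of a compact Lie group is convolution with the kernel
  `K_t = ∑_α e^{-λ_α t} d_α χ_α` (sum over the irreducible classes `α`, `Δ φ = -λ_α φ` on the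
  isotypic block `H_α`), the series converging absolutely and uniformly for `t ≥ δ > 0`; Ch. I §1,
  example: the irreducible characters of the circle group are `θ ↦ e^{ikθ}`, `k ∈ ℤ`.
  [cite: Stein1970, Ch. II §1, Thm 1 and formula (c)]

For `G = U(1)`, `Δ = d²/dθ²` (`λ_k = k²`, `d_k = 1`) and the probabilists' time normalisation
`e^{tΔ/2}` of `HeatKernelGroup.lean`, formula (c) reads `p_t(e^{iθ}) = ∑ₖ e^{-k²t/2} e^{ikθ}`,
which is Mathlib's `jacobiTheta₂ (θ/2π) (it/2π) = ∑ₖ cexp (2πi k (θ/2π) + πi k² (it/2π))` term by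
term; its real form `∑ₖ e^{-k²t/2} cos kθ` is the definition of `circleHeatKernel`.

## The argument

Termwise, `jacobiTheta₂_term k (θ/2π) (it/2π) = exp (ikθ - k²t/2)` (`re_jacobiTheta₂_term_circle`),
whose real part is the `k`-th term `e^{-k²t/2} cos (kθ) = e^{-k²t/2} Re (e^{iθ})ᵏ`
(`re_coe_circleExp_zpow`) of `circleHeatKernel t (e^{iθ})`.  The theta series is absolutely
summable for `t > 0` (`summable_jacobiTheta₂_term_iff`, as `Im (it/2π) = t/2π > 0`), so real parts
may be taken termwise (`Complex.re_tsum`): `circleHeatKernel t (e^{iθ}) = Re ϑ(θ/2π, it/2π)`.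
Finally the theta value is real, because `conj (ϑ z τ) = ϑ (conj z) (-conj τ)` (`jacobiTheta₂_conj`)
and here `z = θ/2π` is real and `τ = it/2π` purely imaginary.
-/

open Complex
open scoped ComplexConjugate

namespace Literature.MathematicalPhysics.QuantumLattice

/-- `Re (e^{iθ})ⁿ = cos (nθ)` for `n ∈ ℤ`. [folklore] -/
theorem re_coe_circleExp_zpow (θ : ℝ) (n : ℤ) :
    (((Circle.exp θ ^ n : Circle) : ℂ)).re = Real.cos (n * θ) := by
  have h : (n : ℂ) * ((θ : ℂ) * I) = ((n * θ : ℝ) : ℂ) * I := by push_cast; ring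
  rw [Circle.coe_zpow, Circle.coe_exp, ← Complex.exp_int_mul, h, exp_ofReal_mul_I_re]

/-- The real part of the `n`-th theta term at `z = θ/2π`, `τ = it/2π` is `e^{-n²t/2} cos (nθ)`:
`Re exp (2πi n (θ/2π) + πi n² (it/2π)) = Re exp (inθ - n²t/2)`. [folklore] -/
theorem re_jacobiTheta₂_term_circle (t θ : ℝ) (n : ℤ) :
    (jacobiTheta₂_term n (θ / (2 * Real.pi)) (I * t / (2 * Real.pi))).re =
      Real.exp (-(n : ℝ) ^ 2 * t / 2) * Real.cos (n * θ) := by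
  have hπ : (Real.pi : ℂ) ≠ 0 := ofReal_ne_zero.mpr Real.pi_ne_zero
  have harg : 2 * (Real.pi : ℂ) * I * n * (θ / (2 * Real.pi)) +
      Real.pi * I * (n : ℂ) ^ 2 * (I * t / (2 * Real.pi)) =
        ((-(n : ℝ) ^ 2 * t / 2 : ℝ) : ℂ) + ((n * θ : ℝ) : ℂ) * I := by
    push_cast
    field_simp
    ring_nf
    rw [I_sq]
    ring
  rw [jacobiTheta₂_term, harg, Complex.exp_add, ← ofReal_exp, re_ofReal_mul, exp_ofReal_mul_I_re]

/-- For real `θ` and real `t`, the theta value `ϑ(θ/2π, it/2π)` is invariant under complex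
conjugation (`jacobiTheta₂_conj` with `z` real, `τ` purely imaginary), i.e. it is real.
[folklore] -/
theorem conj_jacobiTheta₂_circle (t θ : ℝ) :
    conj (jacobiTheta₂ (θ / (2 * Real.pi)) (I * t / (2 * Real.pi))) =
      jacobiTheta₂ (θ / (2 * Real.pi)) (I * t / (2 * Real.pi)) := by
  rw [jacobiTheta₂_conj]
  congr 1
  · rw [map_div₀, map_mul, map_ofNat, conj_ofReal, conj_ofReal]
  · rw [map_div₀, map_mul, map_mul, map_ofNat, conj_ofReal, conj_ofReal, conj_I]
    ring

/-- For `t > 0` the circle heat kernel at `e^{iθ}` is the real part of `ϑ(θ/2π, it/2π)`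
(termwise real parts of an absolutely convergent series). [folklore] -/
theorem circleHeatKernel_eq_re_jacobiTheta₂ {t : ℝ} (ht : 0 < t) (θ : ℝ) :
    circleHeatKernel t (Circle.exp θ) =
      (jacobiTheta₂ (θ / (2 * Real.pi)) (I * t / (2 * Real.pi))).re := by
  -- `Im τ = t / 2π > 0`, so the theta series converges absolutely.
  have hτ : 0 < (I * t / (2 * Real.pi) : ℂ).im := by
    rw [show (I * t / (2 * Real.pi) : ℂ) = ((t / (2 * Real.pi) : ℝ) : ℂ) * I by push_cast; ring,
      mul_I_im, ofReal_re]
    positivity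
  have hs : Summable fun n : ℤ => jacobiTheta₂_term n (θ / (2 * Real.pi)) (I * t / (2 * Real.pi)) :=
    (summable_jacobiTheta₂_term_iff _ _).2 hτ
  rw [circleHeatKernel, jacobiTheta₂, Complex.re_tsum hs]
  refine tsum_congr fun n => ?_
  rw [re_coe_circleExp_zpow, re_jacobiTheta₂_term_circle]

/-- **The circle heat kernel is a Jacobi theta value** (discharge of
`circleHeatKernel_eq_jacobiTheta₂`): `p_t(e^{iθ}) = ϑ(θ/2π, it/2π)` for `t > 0` — the character
expansion `K_t = ∑_α e^{-λ_α t} d_α χ_α` of the heat kernel (Stein 1970, Ch. II §1, Theorem 1 and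
formula (c)) for `G = U(1)`, characters `e^{ikθ}` (Ch. I §1), time normalisation `e^{tΔ/2}`.
[cite: Stein1970, Ch. II §1, Thm 1 and formula (c)] -/
theorem circleHeatKernel_eq_jacobiTheta₂_holds : circleHeatKernel_eq_jacobiTheta₂ := by
  intro t ht θ
  rw [circleHeatKernel_eq_re_jacobiTheta₂ ht]
  exact Complex.conj_eq_iff_re.mp (conj_jacobiTheta₂_circle t θ)

end Literature.MathematicalPhysics.QuantumLattice
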